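import Summits.CriticalPhenomena.PercolationContinuityZ3.Theorems.PercNearOneGluingNoHeavyLowerTailSahiOrdinalSum

/-!
# `NoHeavyLowerTail` (crux stmt-CriticalPhenomena-4575), Sahi programme P1: Sahi positivity of every order for every FKG
# weight is preserved under GLUING AT A CUT POINT (linear sums of the posets of join-irreducibles)

Support file (Sahi cell, seat `prim-sahi-p1`, generation 3; `--supports stmt-CriticalPhenomena-4575`).

Call a finite lattice *settled* if every FKG probability weight on it is Sahi-positive of every order (`E_n(f_1,…,f_n) ≥ 0`
for all `n` and all nonnegative monotone `f_i` — Sahi's Conjecture 5 / Lieb–Sahi's Conjecture 1.1 on that lattice).  A *cut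
point* of a lattice `L` is an element `x` comparable to every element; then `L` is the union of the two sublattices
`↓x = {y ≤ x}` and `↑x = {y ≥ x}` glued at `x`.  For a distributive `L` this is the same as saying that the poset of
join-irreducibles is a linear (ordinal) sum `J(L) = J(↓x) ⊕ J(↑x)`.

THIS FILE: **if `↓x` and `↑x` are settled then so is `L`** (`sahiPositive_of_cutPoint`; the blocks are given abstractly by
order embeddings `i : α → L`, `j : β → L` with ranges `↓x`, `↑x`).  This strictly extends the ordinal-sum theorem
`SahiOrdinalSum.sahiPositive_sumLex` (`α ⊕ₗ β` has the cut point `⊤_α`, with `↑⊤_α ≃ WithBot β`), and it is NOT a formal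
consequence of it: `L` is a lattice quotient of `↓x ⊕ₗ ↑x`, not a sublattice, and an FKG weight on `L` need not lift to an FKG
weight on `↓x ⊕ₗ ↑x` (both copies of `x` would have to carry the full mass `μ(x)`).  Example of a newly settled lattice: two
Boolean cubes `2³` glued top-to-bottom (`J = 3 ⊕ 3`, an antichain of three below an antichain of three: `15` elements, four… six
join-irreducibles of width `3`, not planar, no decomposition as `α ⊕ₗ β` into lattices).  New mathematics, not in print.

Proof.  By the antichain basis (`SahiCubeAllOrders.sahiPositive_of_antichainBasis`) it suffices to treat antichain families of
`≥ 3` up-sets.  An up-set containing `x` contains all of `↑x` ("low type"); an up-set avoiding `x` is contained in `↑x ∖ {x}`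
("high type", by comparability); a high and a low up-set are nested, so an antichain family is all-low or all-high.
* All-low: `U_k ∩ ↓x =: W_k` are up-sets of `↓x` containing its top `x`, and the joint moments `μ(∩U) = μ(↑x ∖ x) + μ(∩W)` are
  the moments of the `W_k` under `ν'(a) = μ(a) + μ(↑x ∖ x)·[a = x]` on `↓x`, an FKG probability weight (`isFKGMeasure_glueUp`).
* All-high: `U_k ⊆ ↑x ∖ {x}` are up-sets `V_k` of `↑x` avoiding its bottom `x`; their moments are those under
  `ν''(b) = μ(b) + μ(↓x ∖ x)·[b = x]` on `↑x`, again FKG (`isFKGMeasure_glueDown`).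
Equal moments give equal `E_n` (`sahiE_congr_of_moments`), and the blocks are settled.
-/

namespace Summit.CriticalPhenomena.PercolationContinuityZ3.Theorems.SahiCutPoint

open Finset Function Literature.Combinatorics.Sahi2008
open scoped BigOperators

noncomputable section

/-! ## Blocks of a cut point: order embeddings onto `↓x` and `↑x` preserve the lattice operations -/

section Blocks

variable {L γ : Type*} [Lattice L] [Lattice γ] {x : L}

/-- An order embedding is injective. [folklore] -/
theorem injective_of_le_iff (i : γ → L) (hi : ∀ a a', i a ≤ i a' ↔ a ≤ a') : Injective i := fun a a' h =>
  le_antisymm ((hi a a').1 h.le) ((hi a' a).1 h.ge)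

/-- An order embedding onto the lower block `↓x` preserves `⊓`. [folklore] -/
theorem map_inf_of_range_Iic (i : γ → L) (hi : ∀ a a', i a ≤ i a' ↔ a ≤ a') (hir : ∀ y, y ≤ x ↔ ∃ a, i a = y)
    (a a' : γ) : i (a ⊓ a') = i a ⊓ i a' := by
  have ha : i a ≤ x := (hir _).2 ⟨a, rfl⟩
  obtain ⟨c, hc⟩ := (hir (i a ⊓ i a')).1 (inf_le_left.trans ha)
  refine le_antisymm (le_inf ((hi _ _).2 inf_le_left) ((hi _ _).2 inf_le_right)) ?_
  rw [← hc]
  refine (hi _ _).2 (le_inf ((hi _ _).1 ?_) ((hi _ _).1 ?_))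
  · rw [hc]; exact inf_le_left
  · rw [hc]; exact inf_le_right

/-- An order embedding onto the lower block `↓x` preserves `⊔`. [folklore] -/
theorem map_sup_of_range_Iic (i : γ → L) (hi : ∀ a a', i a ≤ i a' ↔ a ≤ a') (hir : ∀ y, y ≤ x ↔ ∃ a, i a = y)
    (a a' : γ) : i (a ⊔ a') = i a ⊔ i a' := by
  have ha : i a ≤ x := (hir _).2 ⟨a, rfl⟩
  have ha' : i a' ≤ x := (hir _).2 ⟨a', rfl⟩
  obtain ⟨c, hc⟩ := (hir (i a ⊔ i a')).1 (sup_le ha ha')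
  refine le_antisymm ?_ (sup_le ((hi _ _).2 le_sup_left) ((hi _ _).2 le_sup_right))
  rw [← hc]
  refine (hi _ _).2 (sup_le ((hi _ _).1 ?_) ((hi _ _).1 ?_))
  · rw [hc]; exact le_sup_left
  · rw [hc]; exact le_sup_right

/-- An order embedding onto the upper block `↑x` preserves `⊓`. [folklore] -/
theorem map_inf_of_range_Ici (j : γ → L) (hj : ∀ b b', j b ≤ j b' ↔ b ≤ b') (hjr : ∀ y, x ≤ y ↔ ∃ b, j b = y)
    (b b' : γ) : j (b ⊓ b') = j b ⊓ j b' := by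
  have hb : x ≤ j b := (hjr _).2 ⟨b, rfl⟩
  have hb' : x ≤ j b' := (hjr _).2 ⟨b', rfl⟩
  obtain ⟨c, hc⟩ := (hjr (j b ⊓ j b')).1 (le_inf hb hb')
  refine le_antisymm (le_inf ((hj _ _).2 inf_le_left) ((hj _ _).2 inf_le_right)) ?_
  rw [← hc]
  refine (hj _ _).2 (le_inf ((hj _ _).1 ?_) ((hj _ _).1 ?_))
  · rw [hc]; exact inf_le_left
  · rw [hc]; exact inf_le_right

/-- An order embedding onto the upper block `↑x` preserves `⊔`. [folklore] -/
theorem map_sup_of_range_Ici (j : γ → L) (hj : ∀ b b', j b ≤ j b' ↔ b ≤ b') (hjr : ∀ y, x ≤ y ↔ ∃ b, j b = y)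
    (b b' : γ) : j (b ⊔ b') = j b ⊔ j b' := by
  have hb : x ≤ j b := (hjr _).2 ⟨b, rfl⟩
  obtain ⟨c, hc⟩ := (hjr (j b ⊔ j b')).1 (hb.trans le_sup_left)
  refine le_antisymm ?_ (sup_le ((hj _ _).2 le_sup_left) ((hj _ _).2 le_sup_right))
  rw [← hc]
  refine (hj _ _).2 (sup_le ((hj _ _).1 ?_) ((hj _ _).1 ?_))
  · rw [hc]; exact le_sup_left
  · rw [hc]; exact le_sup_right

end Blocks

/-! ## Splitting sums over `L` along the two blocks -/

section Sums

variable {L α β : Type*} [Lattice L] [Fintype L] [DecidableEq L] [Fintype α] [Fintype β] {x : L}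

/-- **Sums over `L` split along the blocks of a cut point**: for order embeddings `i`, `j` with ranges `↓x` and `↑x`
(which overlap exactly in `x`), `Σ_L g = Σ_α g ∘ i + Σ_β g ∘ j − g x`. [folklore] -/
theorem sum_eq_blocks (hcut : ∀ y, y ≤ x ∨ x ≤ y) (i : α → L) (hinj : Injective i) (hir : ∀ y, y ≤ x ↔ ∃ a, i a = y)
    (j : β → L) (hjnj : Injective j) (hjr : ∀ y, x ≤ y ↔ ∃ b, j b = y) (g : L → ℝ) :
    ∑ z, g z = ∑ a, g (i a) + ∑ b, g (j b) - g x := by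
  classical
  have hlo : ∑ a, g (i a) = ∑ z ∈ univ.filter (fun z => z ≤ x), g z := by
    rw [← sum_image (f := g) (s := (univ : Finset α)) (g := i) fun a _ a' _ h => hinj h]
    refine sum_congr ?_ fun _ _ => rfl
    ext z
    simp only [mem_image, mem_univ, true_and, mem_filter]
    exact ⟨fun ⟨a, ha⟩ => (hir z).2 ⟨a, ha⟩, fun hz => (hir z).1 hz⟩
  have hhi : ∑ b, g (j b) = ∑ z ∈ univ.filter (fun z => ¬ z ≤ x), g z + g x := by
    rw [← sum_image (f := g) (s := (univ : Finset β)) (g := j) fun b _ b' _ h => hjnj h]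
    have hset : (univ : Finset β).image j = insert x (univ.filter fun z => ¬ z ≤ x) := by
      ext z
      simp only [mem_image, mem_univ, true_and, mem_insert, mem_filter]
      constructor
      · rintro ⟨b, rfl⟩
        by_cases hb : j b = x
        · exact Or.inl hb
        · exact Or.inr fun hle => hb (le_antisymm hle ((hjr _).2 ⟨b, rfl⟩))
      · rintro (rfl | hz)
        · exact (hjr _).1 le_rfl
        · exact (hjr z).1 ((hcut z).resolve_left hz)
    rw [hset, sum_insert (by simp), add_comm]
  rw [hlo, hhi, ← sum_filter_add_sum_filter_not univ (fun z => z ≤ x) g]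
  ring

end Sums

/-! ## The two auxiliary weights -/

section Weights

variable {L α β : Type*} [Lattice L] [Fintype L] [DecidableEq L] [Lattice α] [Fintype α] [DecidableEq α]
  [Lattice β] [Fintype β] [DecidableEq β] {x : L}

omit [DecidableEq L] [Lattice β] [DecidableEq β] in
/-- **Gluing the upper block onto the top of the lower block.**  For an FKG weight `μ` on `L` with cut point `x` and blocks
`i : α ≃ ↓x`, `j : β ≃ ↑x`: the weight `ν'(a) = μ(i a) + [a = ⊤]·μ(↑x ∖ x)` on `α` (here `i ⊤ = x`) is an FKG probability weight.
[this work] -/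
theorem isFKGMeasure_glueUp [OrderTop α] {μ : L → ℝ} (hμ : IsFKGMeasure μ) (hcut : ∀ y, y ≤ x ∨ x ≤ y)
    (i : α → L) (hi : ∀ a a', i a ≤ i a' ↔ a ≤ a') (hir : ∀ y, y ≤ x ↔ ∃ a, i a = y)
    (j : β → L) (hjnj : Injective j) (hjr : ∀ y, x ≤ y ↔ ∃ b, j b = y) :
    IsFKGMeasure (fun a : α => μ (i a) + if a = ⊤ then (∑ b, μ (j b)) - μ x else 0) := by
  classical
  have hinj := injective_of_le_iff i hi
  obtain ⟨bx, hbx⟩ := (hjr x).1 le_rfl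
  have hm : 0 ≤ (∑ b, μ (j b)) - μ x := by
    have : ∑ b, μ (j b) = ∑ b ∈ univ.erase bx, μ (j b) + μ (j bx) :=
      (sum_erase_add _ _ (mem_univ bx)).symm
    rw [this, hbx, add_sub_cancel_right]
    exact sum_nonneg fun b _ => hμ.nonneg _
  refine ⟨fun a => ?_, ?_, fun a a' => ?_⟩
  · have := hμ.nonneg (i a)
    positivity
  · rw [sum_add_distrib, sum_ite_eq' univ (⊤ : α), if_pos (mem_univ _), ← add_sub_assoc,
      ← sum_eq_blocks hcut i hinj hir j hjnj hjr μ]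
    exact hμ.sum_eq_one
  · have key := hμ.mul_le_mul (i a) (i a')
    rw [← map_inf_of_range_Iic i hi hir, ← map_sup_of_range_Iic i hi hir] at key
    have h0 : ∀ w, 0 ≤ μ w := hμ.nonneg
    by_cases ha : a = ⊤
    · subst ha
      rw [top_inf_eq, top_sup_eq, mul_comm]
    · by_cases ha' : a' = ⊤
      · subst ha'
        rw [inf_top_eq, sup_top_eq]
      · have hinf : a ⊓ a' ≠ ⊤ := fun h => ha (top_le_iff.1 (h ▸ inf_le_left))
        rw [if_neg ha, if_neg ha', if_neg hinf]
        by_cases hsup : a ⊔ a' = ⊤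
        · rw [hsup, if_pos rfl]
          rw [hsup] at key
          nlinarith [h0 (i (a ⊓ a')), h0 (i ⊤), h0 (i a), h0 (i a')]
        · rw [if_neg hsup]
          simpa using key

omit [DecidableEq L] [Lattice α] [DecidableEq α] in
/-- **Gluing the lower block onto the bottom of the upper block.**  For an FKG weight `μ` on `L` with cut point `x` and
blocks `i : α ≃ ↓x`, `j : β ≃ ↑x`: the weight `ν''(b) = μ(j b) + [b = ⊥]·μ(↓x ∖ x)` on `β` (where `j ⊥ = x`) is an FKG
probability weight. [this work] -/
theorem isFKGMeasure_glueDown [OrderBot β] {μ : L → ℝ} (hμ : IsFKGMeasure μ) (hcut : ∀ y, y ≤ x ∨ x ≤ y)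
    (i : α → L) (hinj : Injective i) (hir : ∀ y, y ≤ x ↔ ∃ a, i a = y)
    (j : β → L) (hj : ∀ b b', j b ≤ j b' ↔ b ≤ b') (hjr : ∀ y, x ≤ y ↔ ∃ b, j b = y) :
    IsFKGMeasure (fun b : β => μ (j b) + if b = ⊥ then (∑ a, μ (i a)) - μ x else 0) := by
  classical
  have hjnj := injective_of_le_iff j hj
  obtain ⟨ax, hax⟩ := (hir x).1 le_rfl
  have hm : 0 ≤ (∑ a, μ (i a)) - μ x := by
    have : ∑ a, μ (i a) = ∑ a ∈ univ.erase ax, μ (i a) + μ (i ax) :=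
      (sum_erase_add _ _ (mem_univ ax)).symm
    rw [this, hax, add_sub_cancel_right]
    exact sum_nonneg fun a _ => hμ.nonneg _
  refine ⟨fun b => ?_, ?_, fun b b' => ?_⟩
  · have := hμ.nonneg (j b)
    positivity
  · rw [sum_add_distrib, sum_ite_eq' univ (⊥ : β), if_pos (mem_univ _)]
    have h := sum_eq_blocks hcut i hinj hir j hjnj hjr μ
    rw [hμ.sum_eq_one] at h
    linarith
  · have key := hμ.mul_le_mul (j b) (j b')
    rw [← map_inf_of_range_Ici j hj hjr, ← map_sup_of_range_Ici j hj hjr] at key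
    have h0 : ∀ w, 0 ≤ μ w := hμ.nonneg
    by_cases hb : b = ⊥
    · subst hb
      rw [bot_inf_eq, bot_sup_eq]
    · by_cases hb' : b' = ⊥
      · subst hb'
        rw [inf_bot_eq, sup_bot_eq, mul_comm]
      · have hsup : b ⊔ b' ≠ ⊥ := fun h => hb (le_bot_iff.1 (h ▸ le_sup_left))
        rw [if_neg hb, if_neg hb', if_neg hsup]
        by_cases hinf : b ⊓ b' = ⊥
        · rw [hinf, if_pos rfl]
          rw [hinf] at key
          nlinarith [h0 (j (b ⊔ b')), h0 (j ⊥), h0 (j b), h0 (j b')]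
        · rw [if_neg hinf]
          simpa using key

end Weights

/-! ## The gluing theorem -/

section Main

variable {L α β : Type*} [DistribLattice L] [Fintype L] [DecidableEq L] [Lattice α] [Fintype α] [DecidableEq α]
  [Lattice β] [Fintype β] [DecidableEq β]

/-- **Settledness is preserved under gluing at a cut point.**  Let `x` be a cut point of the finite distributive lattice
`L` (every element is `≤ x` or `≥ x`), and let the blocks `↓x`, `↑x` be presented by order embeddings `i : α → L`,
`j : β → L` with ranges `{y | y ≤ x}` and `{y | x ≤ y}`.  If every FKG probability weight on `α` and every FKG probability
weight on `β` is Sahi-positive of every order, then so is every FKG probability weight on `L`.  Equivalently (Birkhoff):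
settledness of `Down(P₁)` and `Down(P₂)` implies settledness of `Down(P₁ ⊕ P₂)` for the linear sum of finite posets.
[this work] -/
theorem sahiPositive_of_cutPoint (x : L) (hcut : ∀ y, y ≤ x ∨ x ≤ y)
    (i : α → L) (hi : ∀ a a', i a ≤ i a' ↔ a ≤ a') (hir : ∀ y, y ≤ x ↔ ∃ a, i a = y)
    (j : β → L) (hj : ∀ b b', j b ≤ j b' ↔ b ≤ b') (hjr : ∀ y, x ≤ y ↔ ∃ b, j b = y)
    (hα : ∀ ν : α → ℝ, IsFKGMeasure ν → ∀ n, SahiPositive ν n)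
    (hβ : ∀ ν : β → ℝ, IsFKGMeasure ν → ∀ n, SahiPositive ν n)
    {μ : L → ℝ} (hμ : IsFKGMeasure μ) (n : ℕ) : SahiPositive μ n := by
  classical
  have hinj := injective_of_le_iff i hi
  have hjnj := injective_of_le_iff j hj
  obtain ⟨ax, hax⟩ := (hir x).1 le_rfl
  obtain ⟨bx, hbx⟩ := (hjr x).1 le_rfl
  refine SahiCubeAllOrders.sahiPositive_of_antichainBasis hμ (fun k U hU hanti => ?_) n
  -- an up-set containing `x` contains the whole upper block
  have hlow_all : ∀ l, x ∈ U l → ∀ y, x ≤ y → y ∈ U l := fun l hl y hy => hU l hy hl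
  -- an up-set avoiding `x` lies strictly above `x`
  have hhigh_all : ∀ l, x ∉ U l → ∀ y, y ∈ U l → x ≤ y ∧ y ≠ x := by
    intro l hl y hy
    rcases hcut y with h | h
    · exact absurd (hU l h hy) hl
    · exact ⟨h, fun hyx => hl (hyx ▸ hy)⟩
  -- a low member and a high member are nested
  have hnest : ∀ l l', l ≠ l' → x ∈ U l → x ∉ U l' → False := by
    intro l l' hll' hl hl'
    exact hanti hll' fun y hy => hlow_all l hl y (hhigh_all l' hl' y hy).1
  by_cases hlow : ∃ l₀, x ∈ U l₀
  · /- ALL LOW -/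
    obtain ⟨l₀, hl₀⟩ := hlow
    have hall : ∀ l, x ∈ U l := by
      intro l
      by_contra h
      by_cases hl : l = l₀
      · exact h (hl ▸ hl₀)
      · exact hnest l₀ l (Ne.symm hl) hl₀ h
    obtain ⟨W, hW⟩ : ∃ W : Fin (k + 3) → Finset α, ∀ l, W l = univ.filter fun a => i a ∈ U l := ⟨_, fun l => rfl⟩
    have hmemW : ∀ l a, a ∈ W l ↔ i a ∈ U l := fun l a => by rw [hW]; simp
    have hWup : ∀ l, IsUpperSet ((W l : Finset α) : Set α) := by
      intro l a a' haa' ha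
      rw [Finset.mem_coe, hmemW] at ha ⊢
      exact hU l ((hi a a').2 haa') ha
    haveI : Nonempty α := ⟨ax⟩
    letI : OrderTop α := Fintype.toOrderTop α
    have hix : i ⊤ = x := by
      have h1 : i ⊤ ≤ x := (hir _).2 ⟨⊤, rfl⟩
      have h2 : x ≤ i ⊤ := by rw [← hax]; exact (hi _ _).2 le_top
      exact le_antisymm h1 h2
    have hWtop : ∀ l, (⊤ : α) ∈ W l := fun l => (hmemW l ⊤).2 (hix ▸ hall l)
    -- the auxiliary weight on `α`
    obtain ⟨ν, hν⟩ : ∃ ν : α → ℝ, ν = fun a => μ (i a) + if a = ⊤ then (∑ b, μ (j b)) - μ x else 0 := ⟨_, rfl⟩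
    have hνFKG : IsFKGMeasure ν := by rw [hν]; exact isFKGMeasure_glueUp hμ hcut i hi hir j hjnj hjr
    have hmom : ∀ S : Finset (Fin (k + 3)), S.Nonempty →
        ex μ (∏ l ∈ S, setInd (U l)) = ex ν (∏ l ∈ S, setInd (W l)) := by
      intro S _
      -- the moment over `L`, split along the blocks
      have hsplit := sum_eq_blocks hcut i hinj hir j hjnj hjr (fun z => if ∀ l ∈ S, z ∈ U l then μ z else 0)
      have hxin : ∀ l ∈ S, x ∈ U l := fun l _ => hall l
      have hjin : ∀ b, ∀ l ∈ S, j b ∈ U l := fun b l _ => hlow_all l (hall l) (j b) ((hjr _).2 ⟨b, rfl⟩)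
      simp only [if_pos hxin] at hsplit
      have hB : ∑ b, (if ∀ l ∈ S, j b ∈ U l then μ (j b) else 0) = ∑ b, μ (j b) :=
        sum_congr rfl fun b _ => if_pos (hjin b)
      rw [hB] at hsplit
      have hA : ∀ a : α, (if ∀ l ∈ S, a ∈ W l then ν a else 0) =
          (if ∀ l ∈ S, i a ∈ U l then μ (i a) else 0) + if a = ⊤ then (∑ b, μ (j b)) - μ x else 0 := by
        intro a
        have hiff : (∀ l ∈ S, a ∈ W l) ↔ ∀ l ∈ S, i a ∈ U l :=
          ⟨fun h l hl => (hmemW l a).1 (h l hl), fun h l hl => (hmemW l a).2 (h l hl)⟩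
        by_cases h : ∀ l ∈ S, a ∈ W l
        · rw [if_pos h, if_pos (hiff.1 h), hν]
        · have ha : a ≠ ⊤ := fun ha => h fun l _ => ha ▸ hWtop l
          rw [if_neg h, if_neg fun h' => h (hiff.2 h'), if_neg ha, add_zero]
      calc ex μ (∏ l ∈ S, setInd (U l))
          = ∑ z, (if ∀ l ∈ S, z ∈ U l then μ z else 0) := by convert SahiOrdinalSum.ex_prod_setInd μ S U
        _ = ∑ a, (if ∀ l ∈ S, i a ∈ U l then μ (i a) else 0) + ((∑ b, μ (j b)) - μ x) := by
            rw [hsplit]; ring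
        _ = ∑ a, ((if ∀ l ∈ S, i a ∈ U l then μ (i a) else 0) +
              if a = ⊤ then (∑ b, μ (j b)) - μ x else 0) := by
            rw [sum_add_distrib, sum_ite_eq' univ (⊤ : α), if_pos (mem_univ _)]
        _ = ∑ a, (if ∀ l ∈ S, a ∈ W l then ν a else 0) := (sum_congr rfl fun a _ => (hA a).symm)
        _ = ex ν (∏ l ∈ S, setInd (W l)) := by convert (SahiOrdinalSum.ex_prod_setInd ν S W).symm
    rw [sahiE_congr_of_moments μ ν (k + 3) (fun l => setInd (U l)) (fun l => setInd (W l)) hmom]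
    exact hα ν hνFKG (k + 3) _ (fun l a => setInd_nonneg _ _) (fun l => monotone_setInd (hWup l))
  · /- ALL HIGH -/
    push Not at hlow
    obtain ⟨V, hV⟩ : ∃ V : Fin (k + 3) → Finset β, ∀ l, V l = univ.filter fun b => j b ∈ U l := ⟨_, fun l => rfl⟩
    have hmemV : ∀ l b, b ∈ V l ↔ j b ∈ U l := fun l b => by rw [hV]; simp
    have hVup : ∀ l, IsUpperSet ((V l : Finset β) : Set β) := by
      intro l b b' hbb' hb
      rw [Finset.mem_coe, hmemV] at hb ⊢
      exact hU l ((hj b b').2 hbb') hb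
    haveI : Nonempty β := ⟨bx⟩
    letI : OrderBot β := Fintype.toOrderBot β
    have hjx : j ⊥ = x := by
      have h1 : x ≤ j ⊥ := (hjr _).2 ⟨⊥, rfl⟩
      have h2 : j ⊥ ≤ x := by rw [← hbx]; exact (hj _ _).2 bot_le
      exact le_antisymm h2 h1
    have hVbot : ∀ l, (⊥ : β) ∉ V l := fun l h => hlow l (hjx ▸ (hmemV l ⊥).1 h)
    -- the auxiliary weight on `β`
    obtain ⟨ν, hν⟩ : ∃ ν : β → ℝ, ν = fun b => μ (j b) + if b = ⊥ then (∑ a, μ (i a)) - μ x else 0 := ⟨_, rfl⟩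
    have hνFKG : IsFKGMeasure ν := by rw [hν]; exact isFKGMeasure_glueDown hμ hcut i hinj hir j hj hjr
    have hmom : ∀ S : Finset (Fin (k + 3)), S.Nonempty →
        ex μ (∏ l ∈ S, setInd (U l)) = ex ν (∏ l ∈ S, setInd (V l)) := by
      intro S hS
      obtain ⟨l₁, hl₁⟩ := hS
      have hsplit := sum_eq_blocks hcut i hinj hir j hjnj hjr (fun z => if ∀ l ∈ S, z ∈ U l then μ z else 0)
      have hxout : ¬ ∀ l ∈ S, x ∈ U l := fun h => hlow l₁ (h l₁ hl₁)
      -- no point of the lower block lies in a high up-set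
      have hiout : ∀ a, ¬ ∀ l ∈ S, i a ∈ U l := by
        intro a h
        have h1 := (hhigh_all l₁ (hlow l₁) (i a) (h l₁ hl₁))
        exact h1.2 (le_antisymm ((hir _).2 ⟨a, rfl⟩) h1.1)
      simp only [if_neg hxout, sub_zero] at hsplit
      have hA : ∑ a, (if ∀ l ∈ S, i a ∈ U l then μ (i a) else 0) = 0 :=
        sum_eq_zero fun a _ => if_neg (hiout a)
      rw [hA, zero_add] at hsplit
      have hB : ∀ b : β, (if ∀ l ∈ S, b ∈ V l then ν b else 0) =
          (if ∀ l ∈ S, j b ∈ U l then μ (j b) else 0) := by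
        intro b
        have hiff : (∀ l ∈ S, b ∈ V l) ↔ ∀ l ∈ S, j b ∈ U l :=
          ⟨fun h l hl => (hmemV l b).1 (h l hl), fun h l hl => (hmemV l b).2 (h l hl)⟩
        by_cases h : ∀ l ∈ S, b ∈ V l
        · have hb : b ≠ ⊥ := fun hb => hVbot l₁ (hb ▸ h l₁ hl₁)
          rw [if_pos h, if_pos (hiff.1 h), hν]
          show μ (j b) + (if b = ⊥ then (∑ a, μ (i a)) - μ x else 0) = μ (j b)
          rw [if_neg hb, add_zero]
        · rw [if_neg h, if_neg fun h' => h (hiff.2 h')]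
      calc ex μ (∏ l ∈ S, setInd (U l))
          = ∑ z, (if ∀ l ∈ S, z ∈ U l then μ z else 0) := by convert SahiOrdinalSum.ex_prod_setInd μ S U
        _ = ∑ b, (if ∀ l ∈ S, j b ∈ U l then μ (j b) else 0) := hsplit
        _ = ∑ b, (if ∀ l ∈ S, b ∈ V l then ν b else 0) := (sum_congr rfl fun b _ => (hB b).symm)
        _ = ex ν (∏ l ∈ S, setInd (V l)) := by convert (SahiOrdinalSum.ex_prod_setInd ν S V).symm
    rw [sahiE_congr_of_moments μ ν (k + 3) (fun l => setInd (U l)) (fun l => setInd (V l)) hmom]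
    exact hβ ν hνFKG (k + 3) _ (fun l b => setInd_nonneg _ _) (fun l => monotone_setInd (hVup l))

/-- **Cut-point theorem, subtype form.**  If `x` is a cut point of the finite distributive lattice `L` and every FKG
probability weight on the sublattices `↓x = Set.Iic x` and `↑x = Set.Ici x` (with Mathlib's interval lattice structures) is
Sahi-positive of every order, then so is every FKG probability weight on `L`. [this work] -/
theorem sahiPositive_of_cutPoint_Iic_Ici (x : L) (hcut : ∀ y, y ≤ x ∨ x ≤ y)
    [Fintype (Set.Iic x)] [Fintype (Set.Ici x)]
    (hlo : ∀ ν : Set.Iic x → ℝ, IsFKGMeasure ν → ∀ n, SahiPositive ν n)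
    (hhi : ∀ ν : Set.Ici x → ℝ, IsFKGMeasure ν → ∀ n, SahiPositive ν n)
    {μ : L → ℝ} (hμ : IsFKGMeasure μ) (n : ℕ) : SahiPositive μ n :=
  sahiPositive_of_cutPoint x hcut (fun a : Set.Iic x => (a : L)) (fun _ _ => Iff.rfl)
    (fun y => ⟨fun hy => ⟨⟨y, hy⟩, rfl⟩, fun ⟨a, ha⟩ => ha ▸ a.2⟩)
    (fun b : Set.Ici x => (b : L)) (fun _ _ => Iff.rfl)
    (fun y => ⟨fun hy => ⟨⟨y, hy⟩, rfl⟩, fun ⟨b, hb⟩ => hb ▸ b.2⟩) hlo hhi hμ n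

end Main

end

end Summit.CriticalPhenomena.PercolationContinuityZ3.Theorems.SahiCutPoint
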